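import Summits.QuantumFields.YangMills.Theorems.BalabanUVNodesN12FlatCombAxialHnd
import Summits.QuantumFields.YangMills.Theorems.BalabanUVNodesN12FlatIterAxialHndDetSet
import Literature.MathematicalPhysics.QuantumFieldTheory.Balaban1983to89.B14Eq213DetSet
import Summits.QuantumFields.YangMills.Theorems.UnitScaleTiltProp7FlatHolonomy
import HarnessLib

/-!
# BalabanUVNodes ∕ N12 — (β)♭ AT THE RECORD's SHAPES: (i) the letter `hnondeg` at the flat base field in its BILINEAR shape, real form («`s` in the gauge slice and in `ker DΦ(0)`, the Lagrange
# Hessian of `s` against every slice vector of `ker DΦ(0)` vanishes ⟹ `s = 0»; dag-n12-w1's `hMin_of_baseFieldLetters` letter (β) ∕ dag-n12-w3 g0's U2b binder `hnd`, at `U₀ = 1` where `ℓ₀ = 0`) for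
# the three slices typed by this seat; (ii) the geometric letters (L), (Cov) AND (F) DISCHARGED for the record's determining sets `𝐁_k(Z) = B14.Eq213DetSet.Bj M₁ Z k` ([III] (2.13)) — (F) from (Cov)
# by pure block geometry (the corner site of a `k`-block)

Cell `pub-ymgap` (HUMAN RULINGS D-0062 ∕ D-0149), WIDTH SEAT `pub-ymgap-dag-n12-w3` g2 (node N12 = [B15]; key K1⁷ `stmt-QuantumFields-20542`, `--kind proof --supports … --as helper`;
count-neutral).  THEOREMS ONLY (0 `def`); corollaries BY NAME of `N12FlatCombAxialHnd.eq_zero_of_fderiv_msChart_one_eq_zero_of_combAxial`, `N12FlatIterAxialHnd.eq_zero_of_fderiv_msChart_one_eq_zero_of_iterAxial`,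
`N12FlatHierAxialHndDetSet.eq_zero_of_fderiv_msChart_one_eq_zero_of_hierAxial_detSet` through dag-n12-w3 g0's junction `B11Eq177CriticalFamilyDerivative.deriv_deriv_wilsonAction4_expChart_smul_eq` (only the
diagonal `t = s` of the bilinear hypothesis is used).  The complexification (`real_nondegenerate_of_pos` ∕ `hnondeg_of_deriv_deriv_re_pos`, dag-n12-w1 ∕ dag-n12-w2) and the `expMul`∕E3 ↔
`expChart`∕`lieSU (Fin 2)` dictionary (dag-n12-w3 g0's `B16Ineq19FlatSliceChart`) are the consumers' one-liners.

CONTENTS.  §1 `deriv_deriv_eq_zero_of_fderiv_fderiv_diag_eq_zero`, ★★ `hnondeg_real_flat_combAxial`, ★★ `hnondeg_real_flat_iterAxial`, ★★ `hnondeg_real_flat_hierAxial_detSet`.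
§6 ★★ `hloop_Bj_of_line_misses` — LETTER (L) for `𝐁_k(Z)` (`k ≥ 1`) from «one lattice line per direction misses `Z`» (`Γ₀ = Ω₁ᶜ ⊇ Zᶜ`, `Bj_zero` ∕ `maxDomT_subset`).
§7 `blockIter_eq_iterBlockOf` (the two iterated block maps of the tree agree), ★★ `hcov_Bj` — LETTER (Cov) for `𝐁_k(Z)` (`1 ≤ k ≤ m + K`, `1 ≤ M₁`, cover divisibility `L^k M₁ ∣ sitesPerDir 0`): each fine site lies
under its own level-`0` member outside `Ω₁`, else under the centre of its `n`-block at the last scale `n` with `z ∈ Ω_n` (`isBlockUnion_maxDomT(_succ)`).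
§8 `sitesPerDir_eq_mul_pow`, ★ `exists_lastSite` (the corner site `q` of the `k`-block `w` in direction `μ`: `iterBlockOf k q = w` and `iterBlockOf j (q + e_μ) = iterBlockOf j q + e_μ` for all `j ≤ k` — label
arithmetic `w_μ·L^k + L^k − 1`); §9 ★★ `hface_of_hcov` ((Cov) ⟹ (F) for ANY determining set); §10 ★★ `hface_Bj` — LETTER (F) for `𝐁_k(Z)`.  Only (C) for `Bj` remains open (NODE 00 geometry: outer neighbours of
`Γ_{n+1}` have their centres in the shell `Γ_n`).

HONEST FRAMING.  Flat configuration only; REAL statements (𝔰𝔲(N)-valued directions); of the geometric letters only (C) stays displayed ((L), (Cov), (F) proved here for `Bj`); nothing of Bałaban's estimates asserted; N12 NOT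
discharged; K1⁷ NOT closed; counts unmoved (typed 28∕28 · discharged 5∕27); one finite 𝕋⁴ programme at fixed ε — R4 closes the conditional rung `BalabanLadder.UV` only; the Yang–Mills mass gap
(Clay) is NOT proved by any of this; nothing continuum ∕ ℝ⁴ ∕ OS.
-/

noncomputable section

namespace Summit.QuantumFields.YangMills.BalabanUVNodes.N12FlatHndRecordLetters

open scoped BigOperators Matrix.Norms.L2Operator Topology
open Literature.MathematicalPhysics.QuantumFieldTheory.Balaban1983to89
open T4Continuum (T4Family)
open BlockAveragingEMLLinearised (linAvg)
open T4AdjointCovarianceUnitary (lieSU)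
open B15DeterminingSets
open B5Eq118OneStroke (iterBlockOf)
open B10Eq27TorusAxialLog (axialT)
open Node00
open Summit.QuantumFields.YangMills.BalabanUVNodes.N12FlatCombAxialHnd (eq_zero_of_fderiv_msChart_one_eq_zero_of_combAxial)
open Summit.QuantumFields.YangMills.BalabanUVNodes.N12FlatIterAxialHnd (eq_zero_of_fderiv_msChart_one_eq_zero_of_iterAxial)
open Summit.QuantumFields.YangMills.BalabanUVNodes.N12FlatIterAxialHndDetSet (eq_zero_of_fderiv_msChart_one_eq_zero_of_iterAxial_detSet)
open Summit.QuantumFields.YangMills.BalabanUVNodes.N12FlatHierAxialHndDetSet (eq_zero_of_fderiv_msChart_one_eq_zero_of_hierAxial_detSet)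

variable {F : T4Family} {N : ℕ} [NeZero N] {K k : ℕ}

/-- The diagonal of the bilinear flat second variation is the curve form (dag-n12-w3 g0's junction `deriv_deriv_wilsonAction4_expChart_smul_eq`): if `D²(A∘expChart 1)(0)(d, d) = 0` then
`d²∕ds² A(e^{sd})|₀ = 0`. [cite: Balaban1985BackgroundPropagators, (3.6)-(3.7) p.391 (bookkeeping)] -/
theorem deriv_deriv_eq_zero_of_fderiv_fderiv_diag_eq_zero (d : PBond (F.P K) 0 → lieSU (Fin N))
    (h : fderiv ℝ (fun Y => fderiv ℝ (fun Y : PBond (F.P K) 0 → lieSU (Fin N) => wilsonAction4 (expChart (1 : GaugeField (F.P K) 0 (SU N)) Y)) Y) 0 d d = 0) :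
    deriv (deriv fun s : ℝ => wilsonAction4 (expChart (1 : GaugeField (F.P K) 0 (SU N)) (s • d))) 0 = 0 := by
  rw [B11Eq177CriticalFamilyDerivative.deriv_deriv_wilsonAction4_expChart_smul_eq]
  exact h

/-- ★★ **THE LETTER `hnondeg` AT THE FLAT BASE FIELD, REAL FORM, COMB-AXIAL SLICE** (the shape of dag-n12-w1's `hMin_of_baseFieldLetters` letter (β), before complexification: «`s` in the slice and in
`ker DΦ(0)`, Lagrange Hessian of `s` against every slice vector of `ker DΦ(0)` vanishes ⟹ `s = 0`», with `ℓ₀ = 0` at `U₀ = 1` so the Lagrange Hessian is the bare flat second variation): for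
`𝐁 ⊇` all level-`k` bonds, a comb-axial `s` with `DΦ(0)s = 0` and `D²(A∘expChart 1)(0)(s, t) = 0` for all comb-axial `t ∈ ker DΦ(0)` is `0` (only `t = s` is used).
[cite: Balaban1989LargeFieldII, (1.9) p.358, p.359; Balaban1985Variational, (83) p.290, Sect. E p.300] -/
theorem hnondeg_real_flat_combAxial (𝔹 : DetSet (F.P K)) (h𝔹 : ∀ c : PBond (F.P K) k, c ∈ bondsOf (𝔹 k))
    (s : PBond (F.P K) 0 → lieSU (Fin N))
    (hs : ∀ x : Site (F.P K) 0, axialT (fun b : PBond (F.P K) 0 => Multiplicative.ofAdd (s b)) (embIter k (iterBlockOf k x)) x = 1)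
    (hker : fderiv ℝ (msChart F N K k 𝔹 (avgFamily (avOfRecord F N K) (1 : GaugeField (F.P K) 0 (SU N))) (1 : GaugeField (F.P K) 0 (SU N))) 0 s = 0)
    (hq : ∀ t : PBond (F.P K) 0 → lieSU (Fin N),
      (∀ x : Site (F.P K) 0, axialT (fun b : PBond (F.P K) 0 => Multiplicative.ofAdd (t b)) (embIter k (iterBlockOf k x)) x = 1) →
      fderiv ℝ (msChart F N K k 𝔹 (avgFamily (avOfRecord F N K) (1 : GaugeField (F.P K) 0 (SU N))) (1 : GaugeField (F.P K) 0 (SU N))) 0 t = 0 →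
      fderiv ℝ (fun Y => fderiv ℝ (fun Y : PBond (F.P K) 0 → lieSU (Fin N) => wilsonAction4 (expChart (1 : GaugeField (F.P K) 0 (SU N)) Y)) Y) 0 s t = 0) :
    s = 0 :=
  eq_zero_of_fderiv_msChart_one_eq_zero_of_combAxial 𝔹 h𝔹 hs hker (deriv_deriv_eq_zero_of_fderiv_fderiv_diag_eq_zero s (hq s hs hker))

/-- ★★ **THE LETTER `hnondeg` AT THE FLAT BASE FIELD, REAL FORM, ITERATED AXIAL SLICE `Ax_k`** (`𝐁 ⊇` all level-`k` bonds; any recursion family `Q^{(·)}` for the levels' linearised averages).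
[cite: Balaban1989LargeFieldII, (1.9) p.358, p.359; Balaban1985RegularSpaces, (1.19) p.79] -/
theorem hnondeg_real_flat_iterAxial
    (Q : (i : ℕ) → (PBond (F.P K) 0 → Matrix (Fin N) (Fin N) ℂ) → PBond (F.P K) i → Matrix (Fin N) (Fin N) ℂ)
    (hQ0 : ∀ Y, Q 0 Y = Y) (hQs : ∀ (i : ℕ) (Y : PBond (F.P K) 0 → Matrix (Fin N) (Fin N) ℂ) (c : PBond (F.P K) (i + 1)), Q (i + 1) Y c = linAvg (Q i Y) c)
    (𝔹 : DetSet (F.P K)) (h𝔹 : ∀ c : PBond (F.P K) k, c ∈ bondsOf (𝔹 k))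
    (s : PBond (F.P K) 0 → lieSU (Fin N))
    (hs : ∀ m, m < k → ∀ x : Site (F.P K) m,
      axialT (fun b : PBond (F.P K) m => Multiplicative.ofAdd (Q m (fun e => (s e : Matrix (Fin N) (Fin N) ℂ)) b)) (emb (blockOf x)) x = 1)
    (hker : fderiv ℝ (msChart F N K k 𝔹 (avgFamily (avOfRecord F N K) (1 : GaugeField (F.P K) 0 (SU N))) (1 : GaugeField (F.P K) 0 (SU N))) 0 s = 0)
    (hq : ∀ t : PBond (F.P K) 0 → lieSU (Fin N),
      (∀ m, m < k → ∀ x : Site (F.P K) m,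
        axialT (fun b : PBond (F.P K) m => Multiplicative.ofAdd (Q m (fun e => (t e : Matrix (Fin N) (Fin N) ℂ)) b)) (emb (blockOf x)) x = 1) →
      fderiv ℝ (msChart F N K k 𝔹 (avgFamily (avOfRecord F N K) (1 : GaugeField (F.P K) 0 (SU N))) (1 : GaugeField (F.P K) 0 (SU N))) 0 t = 0 →
      fderiv ℝ (fun Y => fderiv ℝ (fun Y : PBond (F.P K) 0 → lieSU (Fin N) => wilsonAction4 (expChart (1 : GaugeField (F.P K) 0 (SU N)) Y)) Y) 0 s t = 0) :
    s = 0 :=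
  eq_zero_of_fderiv_msChart_one_eq_zero_of_iterAxial Q hQ0 hQs 𝔹 h𝔹 hs hker (deriv_deriv_eq_zero_of_fderiv_fderiv_diag_eq_zero s (hq s hs hker))

/-- ★★ **THE LETTER `hnondeg` AT THE FLAT BASE FIELD, REAL FORM, GENERAL DETERMINING SET, `𝐁`-ADAPTED HIERARCHICAL AXIAL SLICE**, modulo the geometric letters (L), (Cov), (C) of
`N12FlatFibreNullSpaceDetSet` ∕ `N12FlatHierAxialHndDetSet`. [cite: Balaban1989LargeFieldII, (1.9) p.358, p.359; Balaban1988Convergent, (2.2) p.255, (2.13) pp.256-257] -/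
theorem hnondeg_real_flat_hierAxial_detSet (hk : k ≤ (F.P K).m + (F.P K).K)
    (Q : (i : ℕ) → (PBond (F.P K) 0 → Matrix (Fin N) (Fin N) ℂ) → PBond (F.P K) i → Matrix (Fin N) (Fin N) ℂ)
    (hQ0 : ∀ Y, Q 0 Y = Y) (hQs : ∀ (i : ℕ) (Y : PBond (F.P K) 0 → Matrix (Fin N) (Fin N) ℂ) (c : PBond (F.P K) (i + 1)), Q (i + 1) Y c = linAvg (Q i Y) c)
    (𝔹 : DetSet (F.P K))
    (hloop : ∀ μ : Fin (F.P K).d, ∃ (j : ℕ) (R : Finset (Site (F.P K) j)), j ≤ k ∧ R.Nonempty ∧ (∀ y ∈ R, y.shift μ ∈ R) ∧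
      ∀ y ∈ R, (⟨y, μ⟩ : PBond (F.P K) j) ∈ bondsOf (𝔹 j))
    (hcov : ∀ z : Site (F.P K) 0, ∃ j, j ≤ k ∧ iterBlockOf j z ∈ 𝔹 j)
    (hconn : ∀ ψ : Site (F.P K) 0 → Matrix (Fin N) (Fin N) ℂ, (∀ j, j ≤ k → ∀ c ∈ bondsOf (𝔹 j), ψ (embIter j c.tgt) = ψ (embIter j c.src)) →
      ∀ j j', j ≤ k → j' ≤ k → ∀ c ∈ bondsOf (𝔹 j), ∀ c' ∈ bondsOf (𝔹 j'), ψ (embIter j c.src) = ψ (embIter j' c'.src))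
    (s : PBond (F.P K) 0 → lieSU (Fin N))
    (hs : ∀ j, j ≤ k → ∀ y ∈ 𝔹 j, ∀ m, m < j → ∀ x : Site (F.P K) m, iterBlockOf j (embIter m x) = y →
      axialT (fun b : PBond (F.P K) m => Multiplicative.ofAdd (Q m (fun e => (s e : Matrix (Fin N) (Fin N) ℂ)) b)) (emb (blockOf x)) x = 1)
    (hker : fderiv ℝ (msChart F N K k 𝔹 (avgFamily (avOfRecord F N K) (1 : GaugeField (F.P K) 0 (SU N))) (1 : GaugeField (F.P K) 0 (SU N))) 0 s = 0)
    (hq : ∀ t : PBond (F.P K) 0 → lieSU (Fin N),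
      (∀ j, j ≤ k → ∀ y ∈ 𝔹 j, ∀ m, m < j → ∀ x : Site (F.P K) m, iterBlockOf j (embIter m x) = y →
        axialT (fun b : PBond (F.P K) m => Multiplicative.ofAdd (Q m (fun e => (t e : Matrix (Fin N) (Fin N) ℂ)) b)) (emb (blockOf x)) x = 1) →
      fderiv ℝ (msChart F N K k 𝔹 (avgFamily (avOfRecord F N K) (1 : GaugeField (F.P K) 0 (SU N))) (1 : GaugeField (F.P K) 0 (SU N))) 0 t = 0 →
      fderiv ℝ (fun Y => fderiv ℝ (fun Y : PBond (F.P K) 0 → lieSU (Fin N) => wilsonAction4 (expChart (1 : GaugeField (F.P K) 0 (SU N)) Y)) Y) 0 s t = 0) :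
    s = 0 :=
  eq_zero_of_fderiv_msChart_one_eq_zero_of_hierAxial_detSet hk Q hQ0 hQs 𝔹 hloop hcov hconn hs hker
    (deriv_deriv_eq_zero_of_fderiv_fderiv_diag_eq_zero s (hq s hs hker))

/-! ## §6 Letter (L) at the record's determining sets `𝐁_k(Z) = Bj M₁ Z k`: a lattice line missing `Z` in every direction suffices -/

section BjLoop

open Literature.MathematicalPhysics.QuantumFieldTheory.Balaban1983to89.B14.Eq213DetSet (Bj Bj_zero maxDomT maxDomT_subset)

variable {P : Params}

/-- ★★ **(L) FOR `𝐁_k(Z)`, `k ≥ 1`, FROM ONE LATTICE LINE MISSING `Z` PER DIRECTION** ([III] (2.13): the finest member of `𝐁_k(Z)` is `Γ₀ = Ω₁ᶜ ⊇ Zᶜ`, `B14.Eq213DetSet.Bj_zero` ∕ `maxDomT_subset`): if for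
every direction `μ` some line of fine sites `{y : y_ν = a_ν, ν ≠ μ}` avoids `Z` (true whenever `Z` sits inside a box with a margin in every direction, as at the N12 endpoint of record), then the
level-`0` `μ`-bonds along that line form the `e_μ`-invariant constrained family of letter (L). [cite: Balaban1988Convergent, (2.2) p.255, (2.13) pp.256-257] -/
theorem hloop_Bj_of_line_misses {M₁ : ℕ} (hM : 1 ≤ M₁) {Z : Set (Site P 0)} {k : ℕ} (hk : 0 < k)
    (hline : ∀ μ : Fin P.d, ∃ a : Site P 0, ∀ y : Site P 0, (∀ ν, ν ≠ μ → y ν = a ν) → y ∉ Z) (μ : Fin P.d) :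
    ∃ (j : ℕ) (R : Finset (Site P j)), j ≤ k ∧ R.Nonempty ∧ (∀ y ∈ R, y.shift μ ∈ R) ∧
      ∀ y ∈ R, (⟨y, μ⟩ : PBond P j) ∈ bondsOf ((Bj M₁ Z k : DetSet P) j) := by
  classical
  obtain ⟨a, ha⟩ := hline μ
  refine ⟨0, Finset.univ.filter (fun y : Site P 0 => ∀ ν, ν ≠ μ → y ν = a ν), Nat.zero_le _, ⟨a, by simp⟩, fun y hy => ?_, fun y hy => ?_⟩
  · simp only [Finset.mem_filter, Finset.mem_univ, true_and] at hy ⊢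
    intro ν hν
    rw [← hy ν hν]
    exact Function.update_of_ne hν _ _
  · simp only [Finset.mem_filter, Finset.mem_univ, true_and] at hy
    have hyZ : y ∉ Z := ha y hy
    rw [Bj_zero hk]
    exact Or.inl fun h => hyZ (maxDomT_subset hM Z 1 h)

end BjLoop

/-! ## §7 Letter (Cov) at the record's determining sets `𝐁_k(Z)`: the regions of the maximal sequence cover the torus -/

section BjCov

open Literature.MathematicalPhysics.QuantumFieldTheory.Balaban1983to89.B14.Eq213DetSet
  (Bj Bj_zero Bj_mid Bj_top maxDomT maxDomT_subset maxDomT_antitone isBlockUnion_maxDomT isBlockUnion_maxDomT_succ)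
open Literature.MathematicalPhysics.QuantumFieldTheory.Balaban1983to89.B14.Eq213MaximalDomains (side)
open Literature.MathematicalPhysics.QuantumFieldTheory.Balaban1983to89.B14.Eq22Determines (blockIter IsBlockUnion)

variable {P : Params}

/-- The two iterated block maps of the tree (`B14.Eq22Determines.blockIter`, `B5Eq118OneStroke.iterBlockOf`) are the same function. [cite: Balaban1987RG1, (0.1) p.251 (bookkeeping)] -/
theorem blockIter_eq_iterBlockOf : ∀ (j : ℕ) (x : Site P 0), B14.Eq22Determines.blockIter j x = iterBlockOf j x
  | 0, _ => rfl
  | j + 1, x => by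
    rw [B14.Eq22Determines.blockIter_succ, B5Eq118OneStroke.iterBlockOf_succ, blockIter_eq_iterBlockOf j x]

/-- ★★ **(Cov) FOR `𝐁_k(Z)`** ([III] (2.13): the maximal sequence `Z = Ω₀ ⊃ Ω₁ ⊃ … ⊃ Ω_k` consists of unions of blocks of their own scale, so every fine site lies in the block tower of a member
site — outside `Ω₁` it is its own level-`0` member, inside it belongs to `Γ_n = Ω_n^{(n)} ∖ Ω_{n+1}^{(n)}` at the LAST scale `n` whose domain contains it): `1 ≤ k ≤ m + K`, `1 ≤ M₁`, and the
cover divisibility `L^k·M₁ ∣ sitesPerDir 0` of r11's torus construction. [cite: Balaban1988Convergent, (2.2) p.255, (2.13) pp.256-257] -/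
theorem hcov_Bj {M₁ : ℕ} (hM : 1 ≤ M₁) {Z : Set (Site P 0)} {k : ℕ} (hk : 1 ≤ k) (hkK : k ≤ P.m + P.K)
    (hdiv : side P.L M₁ k ∣ P.sitesPerDir 0) (z : Site P 0) :
    ∃ j, j ≤ k ∧ iterBlockOf j z ∈ (Bj M₁ Z k : DetSet P) j := by
  classical
  by_cases h1 : z ∈ maxDomT M₁ Z 1
  · -- the last scale `n ≤ k` whose domain contains `z`
    set n := Nat.findGreatest (fun i => z ∈ maxDomT M₁ Z i) k with hn
    have hnk : n ≤ k := Nat.findGreatest_le k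
    have hn1 : 1 ≤ n := Nat.le_findGreatest (P := fun i => z ∈ maxDomT M₁ Z i) hk h1
    have hzn : z ∈ maxDomT M₁ Z n := Nat.findGreatest_spec (P := fun i => z ∈ maxDomT M₁ Z i) hk h1
    -- the centre of the `n`-block of `z` lies in `Ω_n` (a union of `n`-blocks)
    have hctr : embIter n (iterBlockOf n z) ∈ maxDomT M₁ Z n := by
      rw [← blockIter_eq_iterBlockOf]
      exact (isBlockUnion_maxDomT hM hdiv hn1 hnk (hnk.trans hkK) z).1 hzn
    refine ⟨n, hnk, ?_⟩
    rcases hnk.lt_or_eq with hlt | heq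
    · -- `1 ≤ n < k`: member of `Γ_n = Ω_n^{(n)} ∖ Ω_{n+1}^{(n)}`
      rw [Bj_mid hn1 hlt]
      refine ⟨B15DeterminingSets.mem_pts.2 hctr, fun hmem => ?_⟩
      have hz1 : z ∈ maxDomT M₁ Z (n + 1) := by
        have h := B15DeterminingSets.mem_pts.1 hmem
        rw [← blockIter_eq_iterBlockOf] at h
        exact (isBlockUnion_maxDomT_succ hM hdiv (show n + 1 ≤ k from hlt) (hnk.trans hkK) z).2 h
      have : n + 1 ≤ n := Nat.le_findGreatest (P := fun i => z ∈ maxDomT M₁ Z i) (show n + 1 ≤ k from hlt) hz1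
      omega
    · -- `n = k`: member of `Γ_k = Ω_k^{(k)}`
      rw [heq] at hctr ⊢
      rw [Bj_top]
      exact B15DeterminingSets.mem_pts.2 hctr
  · -- outside `Ω₁`: its own level-`0` member
    refine ⟨0, Nat.zero_le _, ?_⟩
    rw [Bj_zero hk, B5Eq118OneStroke.iterBlockOf_zero]
    exact h1

end BjCov

section FaceLetter

open Literature.MathematicalPhysics.QuantumFieldTheory.Balaban1983to89.B14.Eq213DetSet (Bj)
open Literature.MathematicalPhysics.QuantumFieldTheory.Balaban1983to89.B14.Eq213MaximalDomains (side)
open Summit.QuantumFields.YangMills.Theorems.Prop7AxialGaugeFace (exists_off_embIter)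
open Summit.QuantumFields.YangMills.Theorems.Prop7FlatHolonomy (sitesPerDir_zero_eq_mul_pow)
open Summit.QuantumFields.YangMills.BalabanUVNodes.N12FlatHierAxialHndDetSet (iterBlockOf_embIter_iterBlockOf)
open B5Eq118OneStroke (iterBlockOf_succ val_iterBlockOf)

variable {P : Params}

/-! ## §8 The corner site of a `k`-block in a given direction -/

/-- `N_j = N_k · L^{k−j}` for `j ≤ k ≤ m + K` (site counts per direction along the tower). [cite: Balaban1987RG1, (0.1) p.251] -/
theorem sitesPerDir_eq_mul_pow {j k : ℕ} (hk : k ≤ P.m + P.K) (hjk : j ≤ k) : P.sitesPerDir j = P.sitesPerDir k * P.L ^ (k - j) := by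
  have h0j := sitesPerDir_zero_eq_mul_pow (P := P) (hjk.trans hk)
  have h0k := sitesPerDir_zero_eq_mul_pow (P := P) hk
  have hLj : 0 < P.L ^ j := pow_pos P.L_pos j
  obtain ⟨e, rfl⟩ : ∃ e, k = j + e := ⟨k - j, by omega⟩
  rw [Nat.add_sub_cancel_left]
  rw [h0j, pow_add] at h0k
  exact Nat.eq_of_mul_eq_mul_right hLj (by rw [h0k]; ring)

/-- ★ **THE CORNER SITE**: for a `k`-site `w` and a direction `μ` (`k ≤ m + K`) there is a fine site `q` in the `k`-block `w` such that for EVERY `j ≤ k` the `j`-block of `q + e_μ` is the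
`μ`-neighbour of the `j`-block of `q` (take `q` = the last site of the block `w` in direction `μ` on the line of `k`-centres: label `w_μ·L^k + L^k − 1`, the other labels those of `embIter k w`).
[cite: Balaban1987RG1, (0.1)-(0.3) pp.251-252] -/
theorem exists_lastSite {k : ℕ} (hk : k ≤ P.m + P.K) (w : Site P k) (μ : Fin P.d) :
    ∃ q : Site P 0, iterBlockOf k q = w ∧ ∀ j, j ≤ k → iterBlockOf j (q.shift μ) = (iterBlockOf j q).shift μ := by
  obtain ⟨off, hoffle, hoff⟩ := exists_off_embIter (P := P) k hk
  have hL : 0 < P.L := P.L_pos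
  have hLk : 0 < P.L ^ k := pow_pos hL k
  have hoffL : off < P.L ^ k := by omega
  have hN0 : P.sitesPerDir 0 = P.sitesPerDir k * P.L ^ k := sitesPerDir_zero_eq_mul_pow hk
  -- the corner label in direction `μ`
  set a : ℕ := (w μ).val * P.L ^ k + (P.L ^ k - 1) with ha
  have ha_lt : a < P.sitesPerDir 0 := by
    have hw : (w μ).val + 1 ≤ P.sitesPerDir k := ZMod.val_lt (w μ)
    rw [hN0, ha]
    have := Nat.mul_le_mul_right (P.L ^ k) hw
    rw [Nat.add_mul, one_mul] at this
    omega
  let q : Site P 0 := fun ν => if ν = μ then ((a : ℕ) : ZMod (P.sitesPerDir 0)) else embIter k w ν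
  have hqμ : (q μ).val = a := by
    show (((if μ = μ then ((a : ℕ) : ZMod (P.sitesPerDir 0)) else embIter k w μ)) : ZMod _).val = a
    rw [if_pos rfl, ZMod.val_natCast, Nat.mod_eq_of_lt ha_lt]
  have hqν : ∀ ν, ν ≠ μ → q ν = embIter k w ν := fun ν hν => if_neg hν
  -- labels of the `j`-blocks of `q`
  have hdiv_a : ∀ j, j ≤ k → a / P.L ^ j = (w μ).val * P.L ^ (k - j) + (P.L ^ (k - j) - 1) := by
    intro j hj
    obtain ⟨e, rfl⟩ : ∃ e, k = j + e := ⟨k - j, by omega⟩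
    rw [Nat.add_sub_cancel_left, ha, pow_add]
    have hLj : 0 < P.L ^ j := pow_pos hL j
    have hLe : 1 ≤ P.L ^ e := Nat.one_le_pow _ _ hL
    -- `w L^j L^e + L^j L^e − 1 = (w L^e + (L^e − 1))·L^j + (L^j − 1)`
    have hrew : (w μ).val * (P.L ^ j * P.L ^ e) + (P.L ^ j * P.L ^ e - 1) = (P.L ^ j - 1) + P.L ^ j * ((w μ).val * P.L ^ e + (P.L ^ e - 1)) := by
      have h1 : 1 ≤ P.L ^ j := Nat.one_le_pow _ _ hL
      have hXY : 1 ≤ P.L ^ j * P.L ^ e := Nat.succ_le_of_lt (Nat.mul_pos hLj (pow_pos hL e))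
      zify [h1, hLe, hXY]
      ring
    rw [hrew, Nat.add_mul_div_left _ _ hLj, Nat.div_eq_of_lt (by omega), zero_add]
  refine ⟨q, ?_, fun j hj => ?_⟩
  · -- `iterBlockOf k q = w`
    funext ν
    apply ZMod.val_injective
    rw [val_iterBlockOf k hk]
    by_cases hν : ν = μ
    · subst hν
      rw [hqμ, hdiv_a k le_rfl, Nat.sub_self, pow_zero, mul_one, Nat.sub_self, add_zero]
    · rw [hqν ν hν, hoff, mul_comm, Nat.mul_add_div hLk, Nat.div_eq_of_lt hoffL, add_zero]
  · -- `iterBlockOf j (q + e_μ) = iterBlockOf j q + e_μ`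
    have hjK : j ≤ P.m + P.K := hj.trans hk
    have hNj : P.sitesPerDir j = P.sitesPerDir k * P.L ^ (k - j) := sitesPerDir_eq_mul_pow hk hj
    have hLj : 0 < P.L ^ j := pow_pos hL j
    funext ν
    apply ZMod.val_injective
    rw [val_iterBlockOf j hjK]
    by_cases hν : ν = μ
    · subst hν
      -- left: `((a + 1) mod N₀) / L^j`; right: `((a / L^j) + 1) mod N_j`
      have hsl : ((q.shift ν) ν).val = (a + 1) % P.sitesPerDir 0 := by
        simp only [Site.shift, Function.update_self]
        rw [ZMod.val_add, hqμ, ZMod.val_one]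
      have hsr : (((iterBlockOf j q).shift ν) ν).val = ((iterBlockOf j q ν).val + 1) % P.sitesPerDir j := by
        simp only [Site.shift, Function.update_self]
        rw [ZMod.val_add, ZMod.val_one]
      rw [hsl, hsr, val_iterBlockOf j hjK, hqμ, hdiv_a j hj, hN0, hNj]
      obtain ⟨e, rfl⟩ : ∃ e, k = j + e := ⟨k - j, by omega⟩
      rw [Nat.add_sub_cancel_left]
      have hLe : 1 ≤ P.L ^ e := Nat.one_le_pow _ _ hL
      have ha1 : a + 1 = ((w ν).val + 1) * P.L ^ e * P.L ^ j := by
        have hXY : 1 ≤ P.L ^ j * P.L ^ e := Nat.succ_le_of_lt (Nat.mul_pos hLj (pow_pos hL e))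
        rw [ha, pow_add]; zify [hLe, hXY]; ring
      have hr1 : (w ν).val * P.L ^ e + (P.L ^ e - 1) + 1 = ((w ν).val + 1) * P.L ^ e := by zify [hLe]; ring
      rw [ha1, hr1, show P.sitesPerDir (j + e) * P.L ^ (j + e) = P.sitesPerDir (j + e) * P.L ^ e * P.L ^ j by rw [pow_add]; ring,
        Nat.mul_mod_mul_right, Nat.mul_div_cancel _ hLj, Nat.mul_mod_mul_right]
    · -- other coordinates are untouched by the shift
      have hl : (q.shift μ) ν = q ν := by simp [Site.shift, Function.update_of_ne hν]
      have hr : ((iterBlockOf j q).shift μ) ν = iterBlockOf j q ν := by simp [Site.shift, Function.update_of_ne hν]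
      rw [hl, hr, val_iterBlockOf j hjK]

/-! ## §9 (Cov) ⟹ (F) -/

/-- ★★ **THE FACE LETTER FROM THE COVERAGE LETTER**: if every fine site lies in the block tower of a member site of `𝐁` (levels `≤ k`, `k ≤ m + K`), then every `k`-block face is crossed by a
constrained bond: for the corner site `q` of §1, (Cov) gives a member `y = iterBlockOf j q ∈ Γ_j`; the bond `⟨y, μ⟩` meets `Γ_j`, and the `j`-fold centres of its ends lie in the `k`-blocks `w` and
`w + e_μ` (`iterBlockOf_embIter_iterBlockOf`); see §8. [cite: Balaban1988Convergent, (2.2) p.255, (2.13) pp.256-257] -/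
theorem hface_of_hcov {k : ℕ} (hk : k ≤ P.m + P.K) (𝔹 : DetSet P) (hcov : ∀ z : Site P 0, ∃ j, j ≤ k ∧ iterBlockOf j z ∈ 𝔹 j)
    (w : Site P k) (μ : Fin P.d) :
    ∃ (j : ℕ) (c : PBond P j), j ≤ k ∧ c ∈ bondsOf (𝔹 j) ∧ iterBlockOf k (embIter j c.src) = w ∧ iterBlockOf k (embIter j c.tgt) = w.shift μ := by
  obtain ⟨q, hqw, hqsh⟩ := exists_lastSite hk w μ
  obtain ⟨j, hj, hy⟩ := hcov q
  refine ⟨j, ⟨iterBlockOf j q, μ⟩, hj, Or.inl hy, ?_, ?_⟩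
  · rw [iterBlockOf_embIter_iterBlockOf hk hj, hqw]
  · show iterBlockOf k (embIter j ((iterBlockOf j q).shift μ)) = w.shift μ
    rw [← hqsh j hj, iterBlockOf_embIter_iterBlockOf hk hj, hqsh k le_rfl, hqw]

/-! ## §10 (F) at the record's `𝐁_k(Z)` -/

/-- ★★ **(F) FOR `𝐁_k(Z)`** (`1 ≤ k ≤ m + K`, `1 ≤ M₁`, cover divisibility `L^k·M₁ ∣ sitesPerDir 0`): from (Cov) (`N12FlatHndRecordLetters.hcov_Bj`) by §2.
[cite: Balaban1988Convergent, (2.2) p.255, (2.13) pp.256-257] -/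
theorem hface_Bj {M₁ : ℕ} (hM : 1 ≤ M₁) {Z : Set (Site P 0)} {k : ℕ} (hk : 1 ≤ k) (hkK : k ≤ P.m + P.K)
    (hdiv : side P.L M₁ k ∣ P.sitesPerDir 0) (w : Site P k) (μ : Fin P.d) :
    ∃ (j : ℕ) (c : PBond P j), j ≤ k ∧ c ∈ bondsOf ((Bj M₁ Z k : DetSet P) j) ∧
      iterBlockOf k (embIter j c.src) = w ∧ iterBlockOf k (embIter j c.tgt) = w.shift μ :=
  hface_of_hcov hkK (Bj M₁ Z k) (hcov_Bj hM hk hkK hdiv) w μ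

end FaceLetter

end Summit.QuantumFields.YangMills.BalabanUVNodes.N12FlatHndRecordLetters

end
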